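import Mathlib
import Summits.SmoothPoincare4.SmoothPoincare4.Theses.ConvexBisection
import Literature.Geometry.Symplectic.SteinTwoHandles

/-!
# Sketch — first lemmas of two crux ideas for `ConvexBisection.AcyclicBisectionExists`
(planner-cruxidea-stmt-SmoothPoincare4-10508-2-0, round 1).  Statements only; nothing is proved.

* `HurwitzTiltExchange.ExchangeLemma` — the linear-algebra heart of card `hurwitz-tilt-exchange`
  (Baykur's trade run from the Akbulut–Matveyev acyclic pair; acyclicity of `X₊` ⇔ the positive
  vanishing-cycle classes span `H₁(F;ℚ)`; Hurwitz moves tilt classes by transvections, common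
  stabilisation pairs add fresh classes).
* `BiLagrangianWallMoves.UpMoveStein` — the UP move of card `bi-lagrangian-wall-moves`
  (Weinstein 2-handles attached on both sides of a common-contact Stein bisection along one seam
  Legendrian give a common-contact Stein bisection of the surgered manifold).
-/

namespace Summit.SmoothPoincare4.SmoothPoincare4.Cruxes.AcyclicBisectionExists

/-! ## Card B: Hurwitz-tilt exchange lemma (pure linear algebra over `ℚ`) -/
namespace HurwitzTiltExchange

/-- A signed vector: (homology class of a vanishing cycle in `H₁(F;ℚ) ≅ ℚ^m`, sign of the
Lefschetz critical point: `true` = positive). -/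
abbrev SVec (m : ℕ) := (Fin m → ℚ) × Bool

/-- A configuration: ambient rank `m = 2g`, the intersection pairing `Ω` on `H₁(F;ℚ)`, and the two
signed sequences of vanishing-cycle classes (side 1 = the ALF on `X̃₁`, side 2 = the ALF on `X̃₂`,
signs with respect to the orientation of `Y = Σ # (S²-bundle)`). -/
structure Config where
  m : ℕ
  Ω : Matrix (Fin m) (Fin m) ℚ
  S₁ : List (SVec m)
  S₂ : List (SVec m)

variable {m : ℕ}

/-- `±1` from a sign. -/
def sgn (b : Bool) : ℚ := if b then 1 else -1

/-- the pairing `x · y = xᵀ Ω y` -/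
def pair (Ω : Matrix (Fin m) (Fin m) ℚ) (x y : Fin m → ℚ) : ℚ := x ⬝ᵥ (Ω.mulVec y)

/-- Picard–Lefschetz transvection of the signed class `a = (v, ε)`: `T_v^{ε}(x) = x + ε (x·v) v`. -/
def tilt (Ω : Matrix (Fin m) (Fin m) ℚ) (a : SVec m) (x : Fin m → ℚ) : Fin m → ℚ :=
  x + (sgn a.2 * pair Ω x a.1) • a.1

/-- Hurwitz move `σᵢ : (a, b) ↦ (T_a^{ε_a} b, a)` on a signed sequence (no-op out of range). -/
def hurwitz (Ω : Matrix (Fin m) (Fin m) ℚ) (L : List (SVec m)) (i : ℕ) : List (SVec m) :=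
  match L[i]?, L[i+1]? with
  | some a, some b => (L.set i (tilt Ω a b.1, b.2)).set (i + 1) a
  | _, _ => L

/-- Inverse Hurwitz move `σᵢ⁻¹ : (a, b) ↦ (b, T_b^{-ε_b} a)`. -/
def hurwitzInv (Ω : Matrix (Fin m) (Fin m) ℚ) (L : List (SVec m)) (i : ℕ) : List (SVec m) :=
  match L[i]?, L[i+1]? with
  | some a, some b => (L.set i b).set (i + 1) (tilt Ω (b.1, !b.2) a.1, a.2)
  | _, _ => L

/-- old classes in the stabilised page `F' = F ∪ (two bands)`: `H₁(F) ⊕ 0`. -/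
def extendVec (v : Fin m → ℚ) : Fin (m + 2) → ℚ := Fin.append v (0 : Fin 2 → ℚ)

/-- the two new classes `u₁, u₂` (curves running once over the new bands). -/
def newVec (m : ℕ) (j : Fin 2) : Fin (m + 2) → ℚ := Fin.append (0 : Fin m → ℚ) (Pi.single j 1)

/-- the extended intersection pairing: `uⱼ · x = γⱼ(x)` for old `x` (the band arcs' intersection
numbers, planner-chosen), `u₁ · u₂ = 1`. -/
def extendForm (Ω : Matrix (Fin m) (Fin m) ℚ) (γ : Fin 2 → Fin m → ℤ) :
    Matrix (Fin (m + 2)) (Fin (m + 2)) ℚ :=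
  Matrix.reindex finSumFinEquiv finSumFinEquiv
    (Matrix.fromBlocks Ω (-(Matrix.of fun j i => (γ j i : ℚ)).transpose)
      (Matrix.of fun j i => (γ j i : ℚ)) !![0, 1; -1, 0])

/-- Common positive stabilisation PAIR of the matched open book (Baykur keeps the binding
connected): side 1 receives `u₁, u₂` as POSITIVE Lefschetz points, side 2 the same curves as
NEGATIVE ones (w.r.t. `Y`). -/
def stab (C : Config) (γ : Fin 2 → Fin C.m → ℤ) : Config where
  m := C.m + 2
  Ω := extendForm C.Ω γ
  S₁ := C.S₁.map (fun v => (extendVec v.1, v.2)) ++ [(newVec C.m 0, true), (newVec C.m 1, true)]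
  S₂ := C.S₂.map (fun v => (extendVec v.1, v.2)) ++ [(newVec C.m 0, false), (newVec C.m 1, false)]

/-- The move set: Hurwitz moves on either side separately (they change neither `X̃ᵢ` nor the common
boundary open book) and common stabilisation pairs. -/
inductive Step : Config → Config → Prop
  | hur₁ (C : Config) (i : ℕ) : Step C { C with S₁ := hurwitz C.Ω C.S₁ i }
  | hurInv₁ (C : Config) (i : ℕ) : Step C { C with S₁ := hurwitzInv C.Ω C.S₁ i }
  | hur₂ (C : Config) (i : ℕ) : Step C { C with S₂ := hurwitz C.Ω C.S₂ i }
  | hurInv₂ (C : Config) (i : ℕ) : Step C { C with S₂ := hurwitzInv C.Ω C.S₂ i }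
  | stab (C : Config) (γ : Fin 2 → Fin C.m → ℤ) : Step C (stab C γ)

/-- the positive classes of both sides = the vanishing-cycle classes of Baykur's `X₊`. -/
def positives (C : Config) : Set (Fin C.m → ℚ) :=
  {v | (v, true) ∈ C.S₁ ∨ (v, true) ∈ C.S₂}

/-- **Exchange lemma (card `hurwitz-tilt-exchange`, first lemma).**  If both signed sequences are
bases of `ℚ^m` and side 1 has as many negatives as side 2 has positives (forced by
`d₃(ξ₁) = d₃(ξ₂)`), then Hurwitz moves and common stabilisation pairs reach a configuration whose
positive classes span — i.e. `b₁(X₊) = 0`, whence both halves of Baykur's bisection of `Σ` are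
ℚ-acyclic.  (Toy-verified: `sim/exchange_lemma.py`.) -/
def ExchangeLemma : Prop :=
  ∀ C : Config,
    C.Ω.transpose = -C.Ω →
    C.S₁.length = C.m → C.S₂.length = C.m →
    Submodule.span ℚ {v | ∃ b, (v, b) ∈ C.S₁} = ⊤ →
    Submodule.span ℚ {v | ∃ b, (v, b) ∈ C.S₂} = ⊤ →
    (C.S₁.filter (fun v => !v.2)).length = (C.S₂.filter (fun v => v.2)).length →
    ∃ C' : Config, Relation.ReflTransGen Step C C' ∧ Submodule.span ℚ (positives C') = ⊤

end HurwitzTiltExchange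

/-! ## Card A: the UP move of the bi-Lagrangian Wall calculus -/
namespace BiLagrangianWallMoves

open scoped Manifold ContDiff
open Literature.Geometry.Symplectic Literature.Topology.FourManifolds

/-- The crux's bisection predicate WITHOUT the acyclicity conjunct: `M = e₁(W₁) ∪ e₂(W₂)`, Stein
halves meeting exactly along their boundaries, complex tangencies pushed forward to one plane
field on the seam. -/
def IsContactSteinBisection (M : Type) [TopologicalSpace M]
    [ChartedSpace (EuclideanSpace ℝ (Fin 4)) M]
    (W₁ : Type) [TopologicalSpace W₁] [ChartedSpace (EuclideanHalfSpace 4) W₁]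
    [IsManifold (𝓡∂ 4) ∞ W₁] [CompactSpace W₁]
    (W₂ : Type) [TopologicalSpace W₂] [ChartedSpace (EuclideanHalfSpace 4) W₂]
    [IsManifold (𝓡∂ 4) ∞ W₂] [CompactSpace W₂]
    (J₁ : SteinStructure W₁) (J₂ : SteinStructure W₂) (e₁ : W₁ → M) (e₂ : W₂ → M) : Prop :=
  Manifold.IsSmoothEmbedding (𝓡∂ 4) (𝓡 4) ∞ e₁ ∧ Manifold.IsSmoothEmbedding (𝓡∂ 4) (𝓡 4) ∞ e₂ ∧
  Set.range e₁ ∪ Set.range e₂ = Set.univ ∧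
  Set.range e₁ ∩ Set.range e₂ = e₁ '' (𝓡∂ 4).boundary W₁ ∧
  Set.range e₁ ∩ Set.range e₂ = e₂ '' (𝓡∂ 4).boundary W₂ ∧
  (∀ w₁ w₂, e₁ w₁ = e₂ w₂ →
    Submodule.map (mfderiv (𝓡∂ 4) (𝓡 4) e₁ w₁).toLinearMap (contactPlane J₁.J w₁) =
      Submodule.map (mfderiv (𝓡∂ 4) (𝓡 4) e₂ w₂).toLinearMap (contactPlane J₂.J w₂))

/-- **UP move (card `bi-lagrangian-wall-moves`, first lemma).**  Let `M = e₁(W₁) ∪ e₂(W₂)` be a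
common-contact Stein bisection and let `Pᵢ = Wᵢ ∪ hᵢ` be 2-handle attachments along attaching
circles that are ONE Legendrian knot of the seam (`e₁ ∘ K₁ = e₂ ∘ K₂`) with framing `tb - 1` on
each side (twisting `-1`).  Then `P₁`, `P₂` carry Stein structures (Gompf Thm 1.3) which again form
a common-contact Stein bisection of a closed smooth 4-manifold `M'` (on paper: `M' = M` surgered
along the seam knot `= M # S²×S²` or `M # S²×̃S²`; Legendrian surgery on both sides is canonical,
so the new seam structures match). -/
def UpMoveStein : Prop :=
  ∀ (M : Type) [TopologicalSpace M] [T2Space M] [SecondCountableTopology M] [CompactSpace M]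
    [ChartedSpace (EuclideanSpace ℝ (Fin 4)) M] [IsManifold (𝓡 4) ∞ M]
    (W₁ : Type) [TopologicalSpace W₁] [T2Space W₁] [ChartedSpace (EuclideanHalfSpace 4) W₁]
    [IsManifold (𝓡∂ 4) ∞ W₁] [CompactSpace W₁]
    (W₂ : Type) [TopologicalSpace W₂] [T2Space W₂] [ChartedSpace (EuclideanHalfSpace 4) W₂]
    [IsManifold (𝓡∂ 4) ∞ W₂] [CompactSpace W₂]
    (J₁ : SteinStructure W₁) (J₂ : SteinStructure W₂) (e₁ : W₁ → M) (e₂ : W₂ → M),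
    IsContactSteinBisection M W₁ W₂ J₁ J₂ e₁ e₂ →
    ∀ (h₁ : HandleAttachingMap 3 2 W₁) (h₂ : HandleAttachingMap 3 2 W₂)
      (P₁ : Type) [TopologicalSpace P₁] [T2Space P₁] [ChartedSpace (EuclideanHalfSpace 4) P₁]
      [IsManifold (𝓡∂ 4) ∞ P₁] [CompactSpace P₁]
      (P₂ : Type) [TopologicalSpace P₂] [T2Space P₂] [ChartedSpace (EuclideanHalfSpace 4) P₂]
      [IsManifold (𝓡∂ 4) ∞ P₂] [CompactSpace P₂],
      HandleAttachingMap.IsMultiAttachment (fun _ : Unit => h₁) (𝓡∂ 4) P₁ →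
      HandleAttachingMap.IsMultiAttachment (fun _ : Unit => h₂) (𝓡∂ 4) P₂ →
      (∀ θ, e₁ (h₁.attachingCircle θ) = e₂ (h₂.attachingCircle θ)) →
      IsLegendrianKnot J₁.J h₁.attachingCircle → IsLegendrianKnot J₂.J h₂.attachingCircle →
      J₁.twisting h₁.attachingCircle h₁.attachingFraming = -1 →
      J₂.twisting h₂.attachingCircle h₂.attachingFraming = -1 →
      ∃ (M' : Type) (_ : TopologicalSpace M') (_ : T2Space M') (_ : SecondCountableTopology M')
        (_ : CompactSpace M') (_ : ChartedSpace (EuclideanSpace ℝ (Fin 4)) M')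
        (_ : IsManifold (𝓡 4) ∞ M')
        (J₁' : SteinStructure P₁) (J₂' : SteinStructure P₂) (e₁' : P₁ → M') (e₂' : P₂ → M'),
        IsContactSteinBisection M' P₁ P₂ J₁' J₂' e₁' e₂'

end BiLagrangianWallMoves

end Summit.SmoothPoincare4.SmoothPoincare4.Cruxes.AcyclicBisectionExists
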